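import Mathlib.Algebra.MvPolynomial.Degrees
import Mathlib.Data.ZMod.Basic
import Mathlib.Order.Filter.AtTopBot.Basic
import Literature.NumberTheory.LFunctions.MoebiusWalshCircuits
import HarnessLib
import HarnessLib.Audit

/-!
# Kalai's Möbius-randomness conjectures above `AC⁰` (open problems, statements only)

Companion of `MoebiusWalshCircuits.lean` (Green 2012 / Bourgain 2013: `μ`, `λ` are orthogonal to
`AC⁰` and to every Walsh character). One rung up NOTHING is proved; what IS in print is the list
of conjectures posed by G. Kalai — MathOverflow question 57543 *Walsh Fourier transform of the
Möbius function* (March 2011; its `AC⁰` and uniform-Walsh parts were answered by Green and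
Bourgain) and restated as open in his survey post of 15 December 2024 (sections "Polynomials",
"The ACC(p) and TC0 conjectures"). Following CONVENTIONS §4 they are recorded as
`def … : Prop` [status: open] — never to be asserted — so that routes, refuters and novelty audits
can point at them:

* `kalai_moebius_polylogDegree` — "The correlation between `μ(n)` and every polynomial over
  `ℤ/2ℤ` of degree at most `polylog(n)` [in the binary digits] tends to zero" (by
  Razborov–Smolensky this gives Möbius randomness for `AC⁰[2]`); degree `1` is Bourgain's theorem
  `bourgain_moebius_walsh_uniform`, and already degree `2` is open in general (the digit-local
  Rudin–Shapiro phase `Σ x_i x_{i+1}` is automatic, hence known: Mauduit–Rivat 2015, Müllner 2017);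
* `kalai_moebius_ACC` — "The correlation between the Möbius function `μ(n)` and any function `f`
  computable by a circuit in `ACC(p)`, tends to zero";
* `kalai_moebius_TC0` — "The correlation between the Möbius function and any function `f` …
  described by a circuit in `TC0`, tends to zero" (Kalai's "TC⁰ prime number conjecture").

Formalisation choices (ours, flagged): "degree ≤ polylog(n)" := total degree `≤ (log₂ n)^A` for
each fixed `A`; "tends to zero" := the `ε`-form `|correlation| ≤ ε·2ⁿ` for all large `n`;
circuit classes through the tree's `accBasis p` / `tcBasis` with the negation-free depth
`Circuit.acDepth` and a polynomial size bound `q.eval n` (exactly the data of `AC0Mod p` / `TC0` in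
`Literature.Computability.Complexity.ConstantDepth`); correlations through `circuitCorrelation` of
`MoebiusWalshCircuits.lean` (`Σ_{x ∈ {0,1}ⁿ} μ(val x)·(±1)`, `val x = Σ x_j 2^j`, `μ 0 = 0`).
The route `QuantumAdvantage/MobiusLadder` states the `λ`-analogues of the first and third as its
cruxes `DigitPolyUniformity` and `LiouvilleOrthogonalTC0`; they are NOT restated here.
-/

noncomputable section

namespace Literature.NumberTheory.LFunctions

open Filter Literature.Computability.Complexity

/-- The (unnormalised) correlation of `g : ℕ → ℤ` with the `𝔽₂`-polynomial phase
`(-1)^{P(x)}` on the `n` binary digits: `Σ_{x ∈ {0,1}ⁿ} g(val x)·(-1)^{P(x)}`,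
`val x = Σ_j x_j 2^j` (`bitsToNat (List.ofFn x)`), `P ∈ 𝔽₂[x_0,…,x_{n-1}]` evaluated at the
digit vector. For `P = Σ_{j∈A} x_j` this is `walshSum g A`. [folklore] -/
def polyPhaseCorrelation {n : ℕ} (g : ℕ → ℤ) (P : MvPolynomial (Fin n) (ZMod 2)) : ℝ :=
  ∑ x : Fin n → Bool, (g (bitsToNat (List.ofFn x)) : ℝ) *
    (if MvPolynomial.eval (fun i => if x i then (1 : ZMod 2) else 0) P = 1 then (-1 : ℝ) else 1)

/-- OPEN CONJECTURE, posed by G. Kalai (MathOverflow 57543, 2011; survey post 2024, section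
"Polynomials"): "The correlation between `μ(n)` and every polynomial over `ℤ/2ℤ` of degree at
most `polylog(n)`, tends to zero." Here: for every `A` and `ε > 0`, for all large `n`, every
`P ∈ 𝔽₂[x_0,…,x_{n-1}]` of total degree `≤ (log₂ n)^A` has
`|Σ_{x<2ⁿ} μ(x)(-1)^{P(bits x)}| ≤ ε·2ⁿ`. Degree `≤ 1` is the theorem
`bourgain_moebius_walsh_uniform`; the general degree-`2` case is already open. Never assert.
[status: open] [cite: Kalai2024MobiusRandomness, section "Polynomials"] -/
@[conjecture] def kalai_moebius_polylogDegree : Prop :=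
  ∀ A : ℕ, ∀ ε : ℝ, 0 < ε → ∀ᶠ n : ℕ in atTop, ∀ P : MvPolynomial (Fin n) (ZMod 2),
    P.totalDegree ≤ Nat.log 2 n ^ A →
      |polyPhaseCorrelation (fun m => ArithmeticFunction.moebius m) P| ≤ ε * 2 ^ n

/-- OPEN CONJECTURE, posed by G. Kalai (loc. cit., section "The ACC(p) and TC0 conjectures"):
"The correlation between the Möbius function `μ(n)` and any function `f` computable by a circuit
in `ACC(p)`, tends to zero." Here: for every prime `p`, depth `d`, size polynomial `q` and
`ε > 0`, for all large `n`, every circuit over `accBasis p` (¬, ∧ₖ, ∨ₖ, MOD_{p,k}) with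
`acDepth ≤ d` and `size ≤ q(n)` has `|circuitCorrelation μ C| ≤ ε·2ⁿ`. Never assert.
[status: open] [cite: Kalai2024MobiusRandomness, section "The ACC(p) and TC0 conjectures"] -/
@[conjecture] def kalai_moebius_ACC : Prop :=
  ∀ p : ℕ, p.Prime → ∀ d : ℕ, ∀ q : Polynomial ℕ, ∀ ε : ℝ, 0 < ε → ∀ᶠ n : ℕ in atTop,
    ∀ C : Circuit (Fin n), C.IsOver (accBasis p) → C.acDepth ≤ d → C.size ≤ q.eval n →
      |circuitCorrelation (fun m => ArithmeticFunction.moebius m) C| ≤ ε * 2 ^ n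

/-- OPEN CONJECTURE, posed by G. Kalai (loc. cit.; the "TC⁰ prime number conjecture"): "The
correlation between the Möbius function and any function `f` … described by a circuit in `TC0`,
tends to zero." Here: for every depth `d`, size polynomial `q` and `ε > 0`, for all large `n`,
every circuit over `tcBasis` (¬, ∧ₖ, ∨ₖ, MAJₖ) with `acDepth ≤ d` and `size ≤ q(n)` has
`|circuitCorrelation μ C| ≤ ε·2ⁿ`. The single-gate case (a majority/threshold of digits is
monotone) is covered by Bourgain's monotone corollary (Israel J. Math. 197 (2013), Cor. 2);
depth `≥ 2` is open. Never assert.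
[status: open] [cite: Kalai2024MobiusRandomness, section "The ACC(p) and TC0 conjectures"] -/
@[conjecture] def kalai_moebius_TC0 : Prop :=
  ∀ d : ℕ, ∀ q : Polynomial ℕ, ∀ ε : ℝ, 0 < ε → ∀ᶠ n : ℕ in atTop,
    ∀ C : Circuit (Fin n), C.IsOver tcBasis → C.acDepth ≤ d → C.size ≤ q.eval n →
      |circuitCorrelation (fun m => ArithmeticFunction.moebius m) C| ≤ ε * 2 ^ n

/-- Sanity: the degree-`1` instance of the phase correlation is the Walsh sum of
`MoebiusWalshCircuits.lean` — for `P = Σ_{j∈A} X_j` the phase `(-1)^{P(x)}` is `w_A(x)`, so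
`polyPhaseCorrelation g P = walshSum g A`. Stated for the empty set only (both sides are the plain
sum of `g`), as a check of conventions. [folklore] -/
theorem polyPhaseCorrelation_zero {n : ℕ} (g : ℕ → ℤ) :
    polyPhaseCorrelation (n := n) g 0 = walshSum (n := n) g ∅ := by
  simp [polyPhaseCorrelation, walshSum]

end Literature.NumberTheory.LFunctions

end
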